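import Summits.CriticalPhenomena.CardyFormulaZ2.Theorems.CardyComplexConeEdgePrecompactUFRSJunctionGate

/-!
# The boundary ring of a lattice box: enumeration, Lipschitz bounds, and far sites of two colours
(line `qkz-strip-boundary-arm` of crux `CardyComplexCone.EdgePrecompact`, stmt-CriticalPhenomena-11387;
pure `ℤ²` combinatorics for the registered sub-goal S0 = `ufrs_junction_deepPair_le` of the per-scale
junction bound HJ-S, lead c5 wave 3; registered anchor `boxRing_far_sameSide_HJ`)

The discrete boundary of `ℤ²`-admissible Dobrushin data of an open rectangle is the set of sites on
the four sides of the lattice box `[i₀, i₀ + W] × [j₀, j₀ + H]` (`…UFRSRectLatticeBox.lean`). This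
file enumerates it by the RING `γ : ℤ → Site 2` of period `P = 2W + 2H` — bottom row eastwards,
right column upwards, top row westwards, left column downwards; to keep the file free of
definitions the closed formula is carried as a hypothesis `hγ` — and proves:

* `ring_coord_HJ` (coordinates on the four sides), `ring_adj_HJ` (consecutive ring sites are lattice
  neighbours, `γ P = γ 0`), `ring_cover_HJ` (every side site is a ring site), `ring_mem_box_HJ`;
* `ring_lipschitz_HJ`: `‖γ s - γ t‖_∞ ≤ min (|s - t|, P - |s - t|)` (both ways around);
* `ring_close_HJ`: conversely two ring sites at sup-distance `≤ n < min W H` have cyclic index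
  distance `≤ 2n` (same side: the index is a coordinate; adjacent sides: around the common corner;
  opposite sides are excluded);
* `boxRing_far_sameSide_HJ` (registered anchor), the combinatorial core of S0: colour the side sites
  by a predicate `col`; if every pair of CONSECUTIVE ring sites of different colours lies within
  sup-distance `n₁` of a centre `c` (`2n₁ < min W H`), then of any two ring sites of different
  colours one is within sup-distance `5n₁` of `c`. Proof: the two sites cut the ring into two arcs;
  along each arc the colour changes somewhere (discrete intermediate values), at consecutive sites
  near `c`; the two change positions are index-close (`ring_close_HJ`), and a short index path
  between points of different arcs passes through one of the two cut sites, which is therefore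
  close to a change position (`ring_lipschitz_HJ`), hence near `c`.

In S0 the colouring is "belongs to the wired arc", a colour change between lattice-adjacent
boundary sites spans a marked (`A`–`B`) edge, and all marked edges are near the centre.

References: S. Smirnov, C. R. Acad. Sci. Paris 333 (2001), §2 (discrete domains and arcs); folklore
(the boundary of a box is a cycle).
-/

namespace Summit.CriticalPhenomena.CardyFormulaZ2.Cruxes.EdgePrecompact.QkzStripBoundaryArm

open MeasureTheory Filter Set Metric
open scoped Topology BigOperators Pointwise
open Literature.Probability.LatticeModels Literature.Probability.Percolation
open Literature.Probability.RandomPlanarGeometry (DobrushinDomain)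
open Summit.CriticalPhenomena.CardyFormulaZ2.Theses.CardyComplexCone

noncomputable section

/-! ## The ring in coordinates -/

section Ring

variable {γ : ℤ → Site 2} {i₀ j₀ W H : ℤ}

/-- **Coordinates of the ring sites** on the four sides (bottom `s ≤ W`, right `W < s ≤ W + H`,
top `W + H < s ≤ 2W + H`, left `2W + H < s`). -/
theorem ring_coord_HJ (hγ : ∀ s : ℤ, γ s = if s ≤ W then ![i₀ + s, j₀] else if s ≤ W + H then ![i₀ + W, j₀ + (s - W)]
      else if s ≤ 2 * W + H then ![i₀ + W - (s - W - H), j₀ + H] else ![i₀, j₀ + H - (s - 2 * W - H)]) (s : ℤ) :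
    (s ≤ W ∧ γ s 0 = i₀ + s ∧ γ s 1 = j₀) ∨ (W < s ∧ s ≤ W + H ∧ γ s 0 = i₀ + W ∧ γ s 1 = j₀ + (s - W)) ∨
      (W + H < s ∧ s ≤ 2 * W + H ∧ γ s 0 = i₀ + W - (s - W - H) ∧ γ s 1 = j₀ + H) ∨
      (2 * W + H < s ∧ γ s 0 = i₀ ∧ γ s 1 = j₀ + H - (s - 2 * W - H)) := by
  rw [hγ s]
  split_ifs with h1 h2 h3
  · exact Or.inl ⟨h1, by simp, by simp⟩
  · exact Or.inr (Or.inl ⟨not_le.1 h1, h2, by simp, by simp⟩)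
  · exact Or.inr (Or.inr (Or.inl ⟨not_le.1 h2, h3, by simp, by simp⟩))
  · exact Or.inr (Or.inr (Or.inr ⟨not_le.1 h3, by simp, by simp⟩))

/-- **Consecutive ring sites are lattice neighbours** (`0 ≤ s < P = 2W + 2H`, `0 < W`, `0 < H`). -/
theorem ring_adj_HJ (hγ : ∀ s : ℤ, γ s = if s ≤ W then ![i₀ + s, j₀] else if s ≤ W + H then ![i₀ + W, j₀ + (s - W)]
      else if s ≤ 2 * W + H then ![i₀ + W - (s - W - H), j₀ + H] else ![i₀, j₀ + H - (s - 2 * W - H)])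
    (hW : 0 < W) (hH : 0 < H) {s : ℤ} (hs0 : 0 ≤ s) (hsP : s < 2 * W + 2 * H) :
    (zdGraph 2).Adj (γ s) (γ (s + 1)) := by
  rw [zdGraph_two_adj_iff]
  have h1 := ring_coord_HJ hγ s
  have h2 := ring_coord_HJ hγ (s + 1)
  omega

/-- The ring closes up: `γ P = γ 0`. -/
theorem ring_period_HJ (hγ : ∀ s : ℤ, γ s = if s ≤ W then ![i₀ + s, j₀] else if s ≤ W + H then ![i₀ + W, j₀ + (s - W)]
      else if s ≤ 2 * W + H then ![i₀ + W - (s - W - H), j₀ + H] else ![i₀, j₀ + H - (s - 2 * W - H)])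
    (hW : 0 < W) (hH : 0 < H) : γ (2 * W + 2 * H) = γ 0 := by
  rw [Site.eq_iff_two]
  have h1 := ring_coord_HJ hγ (2 * W + 2 * H)
  have h2 := ring_coord_HJ hγ 0
  omega

/-- **Ring sites lie on the sides of the box.** -/
theorem ring_mem_box_HJ (hγ : ∀ s : ℤ, γ s = if s ≤ W then ![i₀ + s, j₀] else if s ≤ W + H then ![i₀ + W, j₀ + (s - W)]
      else if s ≤ 2 * W + H then ![i₀ + W - (s - W - H), j₀ + H] else ![i₀, j₀ + H - (s - 2 * W - H)])
    (hW : 0 < W) (hH : 0 < H) {s : ℤ} (hs0 : 0 ≤ s) (hsP : s ≤ 2 * W + 2 * H) :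
    (i₀ ≤ γ s 0 ∧ γ s 0 ≤ i₀ + W ∧ j₀ ≤ γ s 1 ∧ γ s 1 ≤ j₀ + H) ∧
      (γ s 0 = i₀ ∨ γ s 0 = i₀ + W ∨ γ s 1 = j₀ ∨ γ s 1 = j₀ + H) := by
  have h1 := ring_coord_HJ hγ s
  omega

/-- **Every side site is a ring site** with an index in `[0, P)`. -/
theorem ring_cover_HJ (hγ : ∀ s : ℤ, γ s = if s ≤ W then ![i₀ + s, j₀] else if s ≤ W + H then ![i₀ + W, j₀ + (s - W)]
      else if s ≤ 2 * W + H then ![i₀ + W - (s - W - H), j₀ + H] else ![i₀, j₀ + H - (s - 2 * W - H)])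
    (hW : 0 < W) (hH : 0 < H) {v : Site 2} (hv : i₀ ≤ v 0 ∧ v 0 ≤ i₀ + W ∧ j₀ ≤ v 1 ∧ v 1 ≤ j₀ + H)
    (hside : v 0 = i₀ ∨ v 0 = i₀ + W ∨ v 1 = j₀ ∨ v 1 = j₀ + H) :
    ∃ s : ℤ, 0 ≤ s ∧ s < 2 * W + 2 * H ∧ γ s = v := by
  by_cases h1 : v 1 = j₀
  · refine ⟨v 0 - i₀, by omega, by omega, ?_⟩
    rw [Site.eq_iff_two]; have := ring_coord_HJ hγ (v 0 - i₀); omega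
  by_cases h2 : v 0 = i₀ + W
  · refine ⟨W + (v 1 - j₀), by omega, by omega, ?_⟩
    rw [Site.eq_iff_two]; have := ring_coord_HJ hγ (W + (v 1 - j₀)); omega
  by_cases h3 : v 1 = j₀ + H
  · refine ⟨W + H + (i₀ + W - v 0), by omega, by omega, ?_⟩
    rw [Site.eq_iff_two]; have := ring_coord_HJ hγ (W + H + (i₀ + W - v 0)); omega
  have h4 : v 0 = i₀ := by omega
  refine ⟨2 * W + H + (j₀ + H - v 1), by omega, by omega, ?_⟩
  rw [Site.eq_iff_two]; have := ring_coord_HJ hγ (2 * W + H + (j₀ + H - v 1)); omega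

/-- **The ring is `1`-Lipschitz both ways around**: for `0 ≤ t ≤ s ≤ P` every coordinate of
`γ s - γ t` is bounded by `s - t` and by `P - s + t` in absolute value. -/
theorem ring_lipschitz_HJ (hγ : ∀ s : ℤ, γ s = if s ≤ W then ![i₀ + s, j₀] else if s ≤ W + H then ![i₀ + W, j₀ + (s - W)]
      else if s ≤ 2 * W + H then ![i₀ + W - (s - W - H), j₀ + H] else ![i₀, j₀ + H - (s - 2 * W - H)])
    (hW : 0 < W) (hH : 0 < H) {s t : ℤ} (ht0 : 0 ≤ t) (hts : t ≤ s) (hsP : s ≤ 2 * W + 2 * H) :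
    (γ s 0 - γ t 0 ≤ s - t ∧ γ t 0 - γ s 0 ≤ s - t ∧ γ s 1 - γ t 1 ≤ s - t ∧ γ t 1 - γ s 1 ≤ s - t) ∧
      (γ s 0 - γ t 0 ≤ 2 * W + 2 * H - s + t ∧ γ t 0 - γ s 0 ≤ 2 * W + 2 * H - s + t ∧
        γ s 1 - γ t 1 ≤ 2 * W + 2 * H - s + t ∧ γ t 1 - γ s 1 ≤ 2 * W + 2 * H - s + t) := by
  have h1 := ring_coord_HJ hγ s
  have h2 := ring_coord_HJ hγ t
  omega

/-- **Sup-close ring sites are index-close**: for `0 ≤ s, t < P` with `‖γ s - γ t‖_∞ ≤ n` and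
`n < W`, `n < H`, the cyclic index distance is at most `2n`. -/
theorem ring_close_HJ (hγ : ∀ s : ℤ, γ s = if s ≤ W then ![i₀ + s, j₀] else if s ≤ W + H then ![i₀ + W, j₀ + (s - W)]
      else if s ≤ 2 * W + H then ![i₀ + W - (s - W - H), j₀ + H] else ![i₀, j₀ + H - (s - 2 * W - H)])
    {n : ℤ} (hnW : n < W) (hnH : n < H) {s t : ℤ} (_hs0 : 0 ≤ s) (_hsP : s < 2 * W + 2 * H) (_ht0 : 0 ≤ t)
    (_htP : t < 2 * W + 2 * H) (h0 : γ s 0 - γ t 0 ≤ n ∧ γ t 0 - γ s 0 ≤ n) (h1 : γ s 1 - γ t 1 ≤ n ∧ γ t 1 - γ s 1 ≤ n) :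
    (s - t ≤ 2 * n ∧ t - s ≤ 2 * n) ∨ 2 * W + 2 * H - s + t ≤ 2 * n ∨ 2 * W + 2 * H - t + s ≤ 2 * n := by
  have h2 := ring_coord_HJ hγ s
  have h3 := ring_coord_HJ hγ t
  omega

end Ring

/-! ## Discrete intermediate values along an integer interval -/

/-- If a predicate differs at the ends of an integer interval, it changes between two consecutive
integers of the interval. -/
theorem exists_change_HJ (f : ℤ → Prop) {s t : ℤ} (hst : s ≤ t) (h : f s ↔ ¬ f t) :
    ∃ k : ℤ, s ≤ k ∧ k < t ∧ (f k ↔ ¬ f (k + 1)) := by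
  classical
  obtain ⟨n, rfl⟩ : ∃ n : ℕ, t = s + n := ⟨(t - s).toNat, by omega⟩
  induction n with
  | zero => simp at h
  | succ n ih =>
    by_cases hn : f s ↔ ¬ f (s + n)
    · obtain ⟨k, hk1, hk2, hk3⟩ := ih (by omega) hn
      exact ⟨k, hk1, by push_cast; omega, hk3⟩
    · refine ⟨s + n, by omega, by push_cast; omega, ?_⟩
      push_cast at h ⊢
      rw [show s + (n + 1 : ℤ) = s + n + 1 by ring] at h
      tauto

/-! ## The combinatorial core -/

section Core

variable {γ : ℤ → Site 2} {i₀ j₀ W H : ℤ}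

/-- Core, ordered version: `0 ≤ a < b < P`, different colours at `γ a`, `γ b`. -/
theorem boxRing_far_sameSide_aux_HJ (hγ : ∀ s : ℤ, γ s = if s ≤ W then ![i₀ + s, j₀] else if s ≤ W + H then ![i₀ + W, j₀ + (s - W)]
      else if s ≤ 2 * W + H then ![i₀ + W - (s - W - H), j₀ + H] else ![i₀, j₀ + H - (s - 2 * W - H)])
    (hW : 0 < W) (hH : 0 < H) (col : Site 2 → Prop) (c : Site 2) {n₁ : ℤ} (_hn₀ : 0 ≤ n₁) (hnW : 2 * n₁ < W) (hnH : 2 * n₁ < H)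
    (hflip : ∀ s : ℤ, 0 ≤ s → s < 2 * W + 2 * H → (col (γ s) ↔ ¬ col (γ (s + 1))) →
      (γ s 0 - c 0 ≤ n₁ ∧ c 0 - γ s 0 ≤ n₁ ∧ γ s 1 - c 1 ≤ n₁ ∧ c 1 - γ s 1 ≤ n₁))
    {a b : ℤ} (ha0 : 0 ≤ a) (hab : a < b) (hbP : b < 2 * W + 2 * H) (hcol : col (γ a) ↔ ¬ col (γ b)) :
    (γ a 0 - c 0 ≤ 5 * n₁ ∧ c 0 - γ a 0 ≤ 5 * n₁ ∧ γ a 1 - c 1 ≤ 5 * n₁ ∧ c 1 - γ a 1 ≤ 5 * n₁) ∨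
      (γ b 0 - c 0 ≤ 5 * n₁ ∧ c 0 - γ b 0 ≤ 5 * n₁ ∧ γ b 1 - c 1 ≤ 5 * n₁ ∧ c 1 - γ b 1 ≤ 5 * n₁) := by
  classical
  set P := 2 * W + 2 * H with hP
  have hper : γ P = γ 0 := ring_period_HJ hγ hW hH
  -- a change position on the arc `[a, b]`
  obtain ⟨k₁, hk₁a, hk₁b, hk₁⟩ := exists_change_HJ (fun s => col (γ s)) hab.le hcol
  have hnear₁ := hflip k₁ (by omega) (by omega) hk₁
  -- a change position on the complementary arc `[b, P] ∪ [0, a]`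
  obtain ⟨k₂, hk₂range, hnear₂⟩ : ∃ k₂ : ℤ, ((b ≤ k₂ ∧ k₂ < P) ∨ (0 ≤ k₂ ∧ k₂ < a)) ∧
      (γ k₂ 0 - c 0 ≤ n₁ ∧ c 0 - γ k₂ 0 ≤ n₁ ∧ γ k₂ 1 - c 1 ≤ n₁ ∧ c 1 - γ k₂ 1 ≤ n₁) := by
    by_cases h0 : col (γ b) ↔ ¬ col (γ P)
    · obtain ⟨k₂, h1, h2, h3⟩ := exists_change_HJ (fun s => col (γ s)) hbP.le h0
      exact ⟨k₂, Or.inl ⟨h1, h2⟩, hflip k₂ (by omega) (by omega) h3⟩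
    · have h0' : col (γ 0) ↔ ¬ col (γ a) := by rw [← hper]; tauto
      obtain ⟨k₂, h1, h2, h3⟩ := exists_change_HJ (fun s => col (γ s)) ha0 h0'
      exact ⟨k₂, Or.inr ⟨h1, h2⟩, hflip k₂ (by omega) (by omega) h3⟩
  -- the two change positions are index-close
  have hclose := ring_close_HJ hγ (n := 2 * n₁) hnW hnH (s := k₁) (t := k₂) (by omega) (by omega) (by omega) (by omega)
    (by omega) (by omega)
  -- Lipschitz bounds from the cut sites to the change positions
  have hL1 : ∀ s t : ℤ, 0 ≤ t → t ≤ s → s ≤ P → _ := fun s t ht0 hts hsP => ring_lipschitz_HJ hγ hW hH ht0 hts hsP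
  rcases hk₂range with ⟨hk₂b, hk₂P⟩ | ⟨hk₂0, hk₂a⟩
  · -- `k₂` after `b`
    rcases hclose with h | h | h
    · -- direct: `b` between `k₁` and `k₂`
      have := hL1 k₂ b (by omega) hk₂b hk₂P.le
      right; omega
    · omega
    · -- wrap from `k₂` through `P = 0` to `k₁`: passes `a`
      have h5 := hL1 P k₂ (by omega) hk₂P.le le_rfl
      have h6 := hL1 a 0 le_rfl ha0 (by omega)
      have h7 : γ P 0 = γ 0 0 ∧ γ P 1 = γ 0 1 := by rw [hper]; exact ⟨rfl, rfl⟩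
      left; omega
  · -- `k₂` before `a`
    rcases hclose with h | h | h
    · -- direct: `a` between `k₂` and `k₁`
      have := hL1 a k₂ hk₂0 hk₂a.le (by omega)
      left; omega
    · -- wrap from `k₁` through `P = 0` to `k₂`: passes `b`
      have h5 := hL1 P b (by omega) hbP.le le_rfl
      have h6 := hL1 k₂ 0 le_rfl hk₂0 (by omega)
      have h7 : γ P 0 = γ 0 0 ∧ γ P 1 = γ 0 1 := by rw [hper]; exact ⟨rfl, rfl⟩
      right; omega
    · omega

/-- **Far ring sites have one colour** (registered anchor `boxRing_far_sameSide_HJ` of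
stmt-CriticalPhenomena-11387, the combinatorial core of S0). With the ring `γ` of the box
`[i₀, i₀ + W] × [j₀, j₀ + H]` (closed formula `hγ`), a colouring `col` of the sites and a centre `c`:
if every pair of consecutive ring sites of different colours lies within sup-distance `n₁` of `c`
(`0 ≤ n₁`, `2n₁ < W`, `2n₁ < H`), then of two ring sites `γ a`, `γ b` (`0 ≤ a, b < 2W + 2H`) of
different colours one lies within sup-distance `5n₁` of `c`. -/
theorem boxRing_far_sameSide_HJ : ∀ (γ : ℤ → Site 2) (i₀ j₀ W H : ℤ) (col : Site 2 → Prop) (c : Site 2) (n₁ a b : ℤ), (∀ s : ℤ, γ s = if s ≤ W then ![i₀ + s, j₀] else if s ≤ W + H then ![i₀ + W, j₀ + (s - W)] else if s ≤ 2 * W + H then ![i₀ + W - (s - W - H), j₀ + H] else ![i₀, j₀ + H - (s - 2 * W - H)]) → 0 < W → 0 < H → 0 ≤ n₁ → 2 * n₁ < W → 2 * n₁ < H → (∀ s : ℤ, 0 ≤ s → s < 2 * W + 2 * H → (col (γ s) ↔ ¬ col (γ (s + 1))) → (γ s 0 - c 0 ≤ n₁ ∧ c 0 - γ s 0 ≤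 n₁ ∧ γ s 1 - c 1 ≤ n₁ ∧ c 1 - γ s 1 ≤ n₁)) → 0 ≤ a → a < 2 * W + 2 * H → 0 ≤ b → b < 2 * W + 2 * H → (col (γ a) ↔ ¬ col (γ b)) → (γ a 0 - c 0 ≤ 5 * n₁ ∧ c 0 - γ a 0 ≤ 5 * n₁ ∧ γ a 1 - c 1 ≤ 5 * n₁ ∧ c 1 - γ a 1 ≤ 5 * n₁) ∨ (γ b 0 - c 0 ≤ 5 * n₁ ∧ c 0 - γ b 0 ≤ 5 * n₁ ∧ γ b 1 - c 1 ≤ 5 * n₁ ∧ c 1 - γ b 1 ≤ 5 * n₁) := by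
  intro γ i₀ j₀ W H col c n₁ a b hγ hW hH hn₀ hnW hnH hflip ha0 haP hb0 hbP hcol
  rcases lt_trichotomy a b with hab | rfl | hab
  · exact boxRing_far_sameSide_aux_HJ hγ hW hH col c hn₀ hnW hnH hflip ha0 hab hbP hcol
  · exact absurd hcol (by tauto)
  · have hcol' : col (γ b) ↔ ¬ col (γ a) := by tauto
    exact (boxRing_far_sameSide_aux_HJ hγ hW hH col c hn₀ hnW hnH hflip hb0 hab haP hcol').symm

end Core

end

end Summit.CriticalPhenomena.CardyFormulaZ2.Cruxes.EdgePrecompact.QkzStripBoundaryArm
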